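import Mathlib
import Literature.NumberTheory.LFunctions.Zhang2022.Section17U021ChiR1Prelims
import Literature.NumberTheory.LFunctions.Zhang2022.Section17MeanSquareMajorant
import Literature.NumberTheory.LFunctions.Zhang2022.ToolkitSmallPrimeFactorSums
import Literature.NumberTheory.LFunctions.Zhang2022.ToolkitDivisorMajorants
import Literature.NumberTheory.LFunctions.Zhang2022.Section15Bcoef
import Literature.NumberTheory.LFunctions.Zhang2022.Section15BcoefSupport
import HarnessLib

/-!
# Zhang (2022) §17.u021, remainder `R₁`: the `m₁`-sum `Σ_{m₁} |b(q₁m₁)|·|κ̄₂(m₁m₂)|/m₁` (piece M1)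

Topic `Literature/NumberTheory/LFunctions/Zhang2022` (Landau–Siegel audit tree; verdict-neutral).
Y. Zhang, *Discrete mean estimates and the Landau–Siegel zero*, arXiv:2211.02515v1 (2022)
[Zhang2022LandauSiegel], §17 p. 98 (tex L4825: "we can drop the terms with `m₂ > 1` … with an
acceptable error") — **an unrefereed manuscript under adjudication; nothing here asserts or denies
its Theorems 1–2, and nothing about Landau–Siegel zeros follows from this file.** THEOREMS ONLY;
0 definitions, 0 named facts (ZHANG-L discharge lane, WP16/§17, sub-leaf `R₁` of
`Typed.Section17.Step17_u021Chi` under the leaf `Eq17_9RelE`; piece (M1) of the owner's cut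
«m₁ inside», HOME/libB/zl-libB-p6/R1-NODE.md).

In the organisation of the `m₂ ≥ 2` remainder `R₁` with the `m₁`-sum innermost, every pair
`(q₁, m₂)` carries the factor

`𝔐(q₁, m₂) = Σ_{m₁ ≥ 1} |b(q₁m₁)|·|κ̄₂(m₁m₂)|/m₁`

(`b` = `Skeleton.bcoef`, the coefficients of (15.1); `κ̄₂` = `Typed.Section17.kappa2bar`). This
file proves (`m1Sum_le`): for all large `D` (no hypothesis (A), the character is not used),

`𝔐(q₁, m₂) ≤ C·τ₂(q₁)·|κ̄₂(m₂)|·(m₂/φ(m₂))²`, `C = C(c′)` absolute in `D, q₁, m₂`.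

Route (Hall–Tenenbaum (0.4) with the prime sum left free, [HallTenenbaum1988]):
`|b(q₁m₁)| ≤ Bτ₂(q₁)τ₂(m₁)` ((15.2), `Skeleton.norm_bcoef_le`, `tau_mul_le`), support of `b` below
`P₄/T` (`Skeleton.bcoef_eq_zero_of_P4_div_bigT_le`), the exact factorisation
`|κ₂(m₂m₁)| = |κ₂(m₂)|·∏_{q∣m₁, q∤m₂}|q^{−ib₁} − 1|` (`Typed.Section17.norm_kappa₂_mul_eq`), then
`MeanSquareMajorant.sum_div_le_exp_sum` for the multiplicative
`f(m₁) = τ₂(m₁)·∏_{q∣m₁,q∤m₂}|q^{−ib₁}−1|` (`f(p) ≤ 2|b₁|log p` off the primes of `m₂`, `f(p) = 2` on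
them): `Σ_{m₁≤N} f(m₁)/m₁ ≤ exp(2|b₁|(log N + log 4) + 2Σ_{p∣m₂}1/p + S₂)` (Mertens
`MertensBound.sum_log_div_prime_le`), with `2|b₁|log(4N) = O_{c′}(1)` (`α log P = π`) and
`exp(Σ_{p∣m₂}1/p) ≤ m₂/φ(m₂)` (Euler's product, `1 − x ≤ e^{−x}`).

## References

* Y. Zhang, arXiv:2211.02515v1 (2022), §17 p. 98 (u020–u021); §15 (15.1)–(15.2) p. 79.
  [cite: Zhang2022LandauSiegel, §17 u021 p.98]
* R. R. Hall, G. Tenenbaum, *Divisors*, CUP 1988, (0.4). [cite: HallTenenbaum1988, (0.4)]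
-/

noncomputable section

open Complex Real Finset ArithmeticFunction

namespace Literature.NumberTheory.LFunctions.Zhang2022.Typed.Section17

open Literature.NumberTheory.LFunctions.Zhang2022
open Literature.NumberTheory.LFunctions.Zhang2022.Skeleton
open Literature.NumberTheory.LFunctions.Zhang2022.MeanSquareMajorant

/-! ## §1. The weight `exp(Σ_{p∣m} 1/p) ≤ m/φ(m)` -/

/-- **Euler's product against the exponential**: `exp(Σ_{p∣m} 1/p) ≤ m/φ(m)` for `m ≥ 1`
(`m/φ(m) = ∏_{p∣m}(1 − 1/p)⁻¹` and `e^{1/p}(1 − 1/p) ≤ 1`). [folklore] -/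
private theorem exp_sum_inv_primeFactors_le_div_totient {m : ℕ} (hm : m ≠ 0) :
    Real.exp (∑ p ∈ m.primeFactors, (p : ℝ)⁻¹) ≤ (m : ℝ) / m.totient := by
  have hφ : (m.totient : ℝ) = m * ∏ p ∈ m.primeFactors, (1 - (p : ℝ)⁻¹) := by
    have h := Nat.totient_eq_mul_prod_factors m
    have h' : ((m.totient : ℚ) : ℝ) = ((m : ℚ) * ∏ p ∈ m.primeFactors, (1 - (p : ℚ)⁻¹) : ℚ) :=
      congrArg (fun x : ℚ => (x : ℝ)) h
    push_cast at h'
    exact h'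
  have hprod_pos : 0 < ∏ p ∈ m.primeFactors, (1 - (p : ℝ)⁻¹) := by
    refine Finset.prod_pos fun p hp => ?_
    have hp2 : (2 : ℝ) ≤ p := by exact_mod_cast (Nat.prime_of_mem_primeFactors hp).two_le
    have : (p : ℝ)⁻¹ ≤ 1 / 2 := by rw [inv_eq_one_div]; exact one_div_le_one_div_of_le (by norm_num) hp2
    linarith
  have hm0 : (0 : ℝ) < m := by exact_mod_cast Nat.pos_of_ne_zero hm
  -- `m/φ(m) = (∏(1 − 1/p))⁻¹`
  have hdiv : (m : ℝ) / m.totient = (∏ p ∈ m.primeFactors, (1 - (p : ℝ)⁻¹))⁻¹ := by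
    rw [hφ, div_mul_eq_div_div, div_self hm0.ne', one_div]
  rw [hdiv, Real.exp_sum, ← Finset.prod_inv_distrib]
  refine Finset.prod_le_prod (fun p _ => (Real.exp_pos _).le) fun p hp => ?_
  have hp2 : (2 : ℝ) ≤ p := by exact_mod_cast (Nat.prime_of_mem_primeFactors hp).two_le
  have hp0 : (0 : ℝ) < p := by linarith
  have hlt : 0 < 1 - (p : ℝ)⁻¹ := by
    have : (p : ℝ)⁻¹ ≤ 1 / 2 := by rw [inv_eq_one_div]; exact one_div_le_one_div_of_le (by norm_num) hp2
    linarith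
  -- `e^{1/p} ≤ (1 − 1/p)⁻¹` iff `e^{1/p}(1 − 1/p) ≤ 1`, and `1 − 1/p ≤ e^{−1/p}`
  rw [le_inv_comm₀ (Real.exp_pos _) hlt, ← Real.exp_neg]
  have := Real.add_one_le_exp (-(p : ℝ)⁻¹)
  linarith

/-- The squared form used by the `R₁` skeleton: `exp(2Σ_{p∣m} 1/p) ≤ (m/φ(m))²` (`m ≥ 1`).
[folklore] -/
private theorem exp_two_mul_sum_inv_primeFactors_le {m : ℕ} (hm : m ≠ 0) :
    Real.exp (2 * ∑ p ∈ m.primeFactors, (p : ℝ)⁻¹) ≤ ((m : ℝ) / m.totient) ^ 2 := by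
  rw [show (2 : ℝ) * ∑ p ∈ m.primeFactors, (p : ℝ)⁻¹ =
      (∑ p ∈ m.primeFactors, (p : ℝ)⁻¹) + ∑ p ∈ m.primeFactors, (p : ℝ)⁻¹ by ring,
    Real.exp_add, sq]
  have h := exp_sum_inv_primeFactors_le_div_totient hm
  exact mul_le_mul h h (Real.exp_pos _).le (le_trans (Real.exp_pos _).le h)

/-! ## §2. The multiplicative weight `f(m₁) = τ₂(m₁)·∏_{q∣m₁, q∉S}|q^{−ib}−1|` -/

section Weight

variable (b : ℝ) (S : Finset ℕ)

/-- `f` is multiplicative on coprime arguments (the prime-factor sets of coprime numbers are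
disjoint). [folklore] -/
private theorem weight_mul_of_coprime {m n : ℕ} (hmn : Nat.Coprime m n) :
    tau 2 (m * n) * ∏ q ∈ (m * n).primeFactors \ S, ‖powI b q - 1‖ =
      (tau 2 m * ∏ q ∈ m.primeFactors \ S, ‖powI b q - 1‖) *
        (tau 2 n * ∏ q ∈ n.primeFactors \ S, ‖powI b q - 1‖) := by
  rcases Nat.eq_zero_or_pos m with rfl | hm
  · simp [ArithmeticFunction.map_zero]
  rcases Nat.eq_zero_or_pos n with rfl | hn
  · simp [ArithmeticFunction.map_zero]
  rw [(isMultiplicative_tau 2).map_mul_of_coprime hmn, Nat.primeFactors_mul hm.ne' hn.ne',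
    Finset.union_sdiff_distrib,
    Finset.prod_union ((Nat.Coprime.disjoint_primeFactors hmn).mono sdiff_subset sdiff_subset)]
  ring

/-- `f(1) = 1`. [folklore] -/
private theorem weight_one :
    tau 2 1 * ∏ q ∈ (1 : ℕ).primeFactors \ S, ‖powI b q - 1‖ = 1 := by
  rw [tau_apply_one, Nat.primeFactors_one, Finset.empty_sdiff, Finset.prod_empty, mul_one]

/-- `f ≥ 0`. [folklore] -/
private theorem weight_nonneg (n : ℕ) :
    0 ≤ tau 2 n * ∏ q ∈ n.primeFactors \ S, ‖powI b q - 1‖ :=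
  mul_nonneg (tau_nonneg 2 n) (Finset.prod_nonneg fun _ _ => norm_nonneg _)

/-- `|q^{−ib} − 1| ≤ 2` for `q ≥ 1`. [folklore] -/
private theorem norm_powI_sub_one_le_two {q : ℕ} (hq : 0 < q) : ‖powI b q - 1‖ ≤ 2 := by
  calc ‖powI b q - 1‖ ≤ ‖powI b q‖ + ‖(1 : ℂ)‖ := norm_sub_le _ _
    _ = 2 := by rw [norm_powI_of_pos b hq, norm_one]; norm_num

/-- `f(p^ν) ≤ (ν+1)²` at prime powers (`τ₂(p^ν) = ν+1`, the product has at most the one factor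
`|p^{−ib}−1| ≤ 2`). [cite: HallTenenbaum1988, (0.4)] -/
private theorem weight_prime_pow_le (p ν : ℕ) (hp : p.Prime) :
    tau 2 (p ^ ν) * ∏ q ∈ (p ^ ν).primeFactors \ S, ‖powI b q - 1‖ ≤ ((ν : ℝ) + 1) ^ 2 := by
  rcases Nat.eq_zero_or_pos ν with rfl | hν
  · rw [pow_zero, weight_one]; norm_num
  rw [tau_two_prime_pow hp, Nat.primeFactors_prime_pow hν.ne' hp]
  have hprod : ∏ q ∈ ({p} : Finset ℕ) \ S, ‖powI b q - 1‖ ≤ 2 := by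
    by_cases hpS : p ∈ S
    · rw [Finset.sdiff_eq_empty_iff_subset.mpr (Finset.singleton_subset_iff.mpr hpS),
        Finset.prod_empty]; norm_num
    · rw [show ({p} : Finset ℕ) \ S = {p} from Finset.sdiff_eq_self_of_disjoint
        (Finset.disjoint_singleton_left.mpr hpS), Finset.prod_singleton]
      exact norm_powI_sub_one_le_two b hp.pos
  have hν1 : (1 : ℝ) ≤ ν := by exact_mod_cast hν
  calc ((ν : ℝ) + 1) * ∏ q ∈ ({p} : Finset ℕ) \ S, ‖powI b q - 1‖ ≤ ((ν : ℝ) + 1) * 2 :=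
        mul_le_mul_of_nonneg_left hprod (by positivity)
    _ ≤ ((ν : ℝ) + 1) ^ 2 := by nlinarith

/-- The prime values: `f(p)/p ≤ 2|b|log p/p + 2·𝟙[p ∈ S]/p`. [cite: HallTenenbaum1988, (0.4)] -/
private theorem weight_prime_div_le {p : ℕ} (hp : p.Prime) :
    tau 2 p * (∏ q ∈ p.primeFactors \ S, ‖powI b q - 1‖) / p ≤
      2 * |b| * Real.log p / p + (if p ∈ S then 2 / (p : ℝ) else 0) := by
  have hp0 : (0 : ℝ) < p := by exact_mod_cast hp.pos
  have hlog : 0 ≤ Real.log p := Real.log_nonneg (by exact_mod_cast hp.one_lt.le)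
  rw [tau_prime 2 hp, Nat.Prime.primeFactors hp]
  by_cases hpS : p ∈ S
  · rw [if_pos hpS, Finset.sdiff_eq_empty_iff_subset.mpr (Finset.singleton_subset_iff.mpr hpS),
      Finset.prod_empty, mul_one]
    have : 0 ≤ 2 * |b| * Real.log p / p := by positivity
    push_cast; linarith
  · rw [if_neg hpS, add_zero, show ({p} : Finset ℕ) \ S = {p} from Finset.sdiff_eq_self_of_disjoint
      (Finset.disjoint_singleton_left.mpr hpS), Finset.prod_singleton]
    push_cast
    rw [div_le_div_iff_of_pos_right hp0]
    have h := norm_powI_sub_one_le b hp.pos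
    nlinarith [norm_nonneg (powI b p - 1)]

/-- The free prime sum: `Σ_{p≤N} f(p)/p ≤ 2|b|(log N + log 4) + 2Σ_{p∈S}1/p` (Mertens' first
theorem, upper half, `MertensBound.sum_log_div_prime_le`). [cite: HallTenenbaum1988, (0.4)] -/
private theorem sum_weight_prime_div_le (N : ℕ) :
    ∑ p ∈ Nat.primesLE N, tau 2 p * (∏ q ∈ p.primeFactors \ S, ‖powI b q - 1‖) / p ≤
      2 * |b| * (Real.log N + Real.log 4) + 2 * ∑ p ∈ S, (p : ℝ)⁻¹ := by
  have hmem : ∀ p ∈ Nat.primesLE N, p.Prime := fun p hp => (Nat.mem_primesLE.mp hp).2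
  calc ∑ p ∈ Nat.primesLE N, tau 2 p * (∏ q ∈ p.primeFactors \ S, ‖powI b q - 1‖) / p
      ≤ ∑ p ∈ Nat.primesLE N, (2 * |b| * Real.log p / p + (if p ∈ S then 2 / (p : ℝ) else 0)) :=
        Finset.sum_le_sum fun p hp => weight_prime_div_le b S (hmem p hp)
    _ = 2 * |b| * ∑ p ∈ Nat.primesLE N, Real.log p / p +
          ∑ p ∈ (Nat.primesLE N).filter (fun p => p ∈ S), 2 / (p : ℝ) := by
        rw [Finset.sum_add_distrib, Finset.mul_sum, Finset.sum_filter]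
        refine congrArg₂ (· + ·) (Finset.sum_congr rfl fun p _ => by ring) rfl
    _ ≤ 2 * |b| * (Real.log N + Real.log 4) + 2 * ∑ p ∈ S, (p : ℝ)⁻¹ := by
        refine add_le_add ?_ ?_
        · exact mul_le_mul_of_nonneg_left (MertensBound.sum_log_div_prime_le N) (by positivity)
        · rw [Finset.mul_sum]
          calc ∑ p ∈ (Nat.primesLE N).filter (fun p => p ∈ S), 2 / (p : ℝ)
              = ∑ p ∈ (Nat.primesLE N).filter (fun p => p ∈ S), 2 * (p : ℝ)⁻¹ :=
                Finset.sum_congr rfl fun p _ => div_eq_mul_inv _ _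
            _ ≤ ∑ p ∈ S, 2 * (p : ℝ)⁻¹ :=
                Finset.sum_le_sum_of_subset_of_nonneg (fun p hp => (Finset.mem_filter.mp hp).2)
                  (fun p _ _ => by positivity)

/-- **The Hall–Tenenbaum bound for the weight**:
`Σ_{m₁≤N} τ₂(m₁)∏_{q∣m₁,q∉S}|q^{−ib}−1|/m₁ ≤ exp(2|b|(log N + log 4) + S₂)·exp(2Σ_{p∈S}1/p)`
(`S` a set of primes; `S₂ = LogEulerProduct.tailConst 2`). [cite: HallTenenbaum1988, (0.4)] -/
theorem sum_tau_mul_prod_sdiff_div_le (N : ℕ) :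
    ∑ m ∈ Icc 1 N, tau 2 m * (∏ q ∈ m.primeFactors \ S, ‖powI b q - 1‖) / m ≤
      Real.exp (2 * |b| * (Real.log N + Real.log 4) + LogEulerProduct.tailConst 2) *
        Real.exp (2 * ∑ p ∈ S, (p : ℝ)⁻¹) := by
  have h := sum_div_le_exp_sum (f := fun m => tau 2 m * ∏ q ∈ m.primeFactors \ S, ‖powI b q - 1‖)
    (weight_one b S) (fun m n hmn => weight_mul_of_coprime b S hmn) (weight_nonneg b S) (d := 2)
    (fun p ν hp => weight_prime_pow_le b S p ν hp) N
  refine h.trans ?_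
  rw [← Real.exp_add, Real.exp_le_exp]
  have := sum_weight_prime_div_le b S N
  linarith

end Weight

/-! ## §3. The `m₁`-sum at a fixed modulus -/

/-- The size of `b₁`: `|b₁| ≤ α(1 + 5|c′|)` once `𝓛 ≥ 2` (`b₁ = α(1 − 5c′α𝓛)`, `α𝓛 = π𝓛⁻⁸ ≤ 1`).
[cite: Zhang2022LandauSiegel, §2 (2.13)] -/
private theorem abs_b1_le (c' : ℝ) {D : ℕ} (hℓ : 2 ≤ ell D) :
    |b1 c' D| ≤ alpha D * (1 + 5 * |c'|) := by
  have hℓ0 : 0 < ell D := by linarith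
  have hα : alpha D = π / ell D ^ 9 := by rw [alpha, bigP, Real.log_exp]
  have hα0 : 0 < alpha D := by rw [hα]; positivity
  have hαℓ : alpha D * ell D ≤ 1 := by
    rw [hα, div_mul_eq_mul_div, div_le_one (by positivity)]
    have h9 : ell D ^ 9 = ell D ^ 8 * ell D := by ring
    have h8 : (256 : ℝ) ≤ ell D ^ 8 := by
      have := pow_le_pow_left₀ (by norm_num : (0:ℝ) ≤ 2) hℓ 8; norm_num at this; exact this
    rw [h9]
    nlinarith [Real.pi_lt_four]
  rw [b1, abs_mul, abs_of_pos hα0]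
  refine mul_le_mul_of_nonneg_left ?_ hα0.le
  calc |1 - 5 * c' * alpha D * ell D| ≤ |(1 : ℝ)| + |5 * c' * alpha D * ell D| := abs_sub _ _
    _ = 1 + 5 * |c'| * (alpha D * ell D) := by
        rw [abs_one, show 5 * c' * alpha D * ell D = 5 * c' * (alpha D * ell D) by ring, abs_mul,
          abs_mul, abs_of_nonneg (by positivity : (0:ℝ) ≤ alpha D * ell D)]
        norm_num
    _ ≤ 1 + 5 * |c'| * 1 := by gcongr
    _ = 1 + 5 * |c'| := by ring

/-- The support bound of the `m₁`-sum: with `N = ⌈P₄/T⌉`, `log N ≤ 521𝓛⁹` (`𝓛 ≥ 3`; crude: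
`P₄/T ≤ P·t₀`). [cite: Zhang2022LandauSiegel, §15 (15.2) p. 79] -/
private theorem log_ceil_P4_div_bigT_le {D : ℕ} (hℓ : 3 ≤ ell D) :
    Real.log (⌈P4 D / bigT D⌉₊ : ℕ) ≤ 521 * ell D ^ 9 := by
  have hℓ1 : 1 ≤ ell D := by linarith
  have hℓ0 : 0 < ell D := by linarith
  have hP : 0 < bigP D := Real.exp_pos _
  have hT1 : 1 ≤ bigT D := by rw [bigT]; exact Real.one_le_exp (by positivity)
  have ht0 : 1 ≤ t0 D := by rw [t0]; exact one_le_pow₀ hℓ1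
  have hP1 : 1 ≤ bigP D := by rw [bigP]; exact Real.one_le_exp (by positivity)
  -- `P₄/T ≤ P t₀`
  have h4 : P4 D / bigT D ≤ bigP D * t0 D := by
    rw [P4, div_le_iff₀ (by linarith)]
    have h1 : bigP D / bigT D ^ 2 ≤ bigP D := div_le_self hP.le (one_le_pow₀ hT1)
    calc bigP D / bigT D ^ 2 * t0 D ≤ bigP D * t0 D := by gcongr
      _ = bigP D * t0 D * 1 := (mul_one _).symm
      _ ≤ bigP D * t0 D * bigT D := by gcongr
  have hPt : 1 ≤ bigP D * t0 D := one_le_mul_of_one_le_of_one_le hP1 ht0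
  -- `N ≤ 2 P t₀`
  have hN : ((⌈P4 D / bigT D⌉₊ : ℕ) : ℝ) ≤ 2 * (bigP D * t0 D) := by
    have hnn : 0 ≤ P4 D / bigT D := by
      have := le_trans (by positivity : (0:ℝ) ≤ bigP D * t0 D) (le_refl _)
      rw [P4]; positivity
    calc ((⌈P4 D / bigT D⌉₊ : ℕ) : ℝ) ≤ P4 D / bigT D + 1 := (Nat.ceil_lt_add_one hnn).le
      _ ≤ bigP D * t0 D + bigP D * t0 D := add_le_add h4 hPt
      _ = 2 * (bigP D * t0 D) := by ring
  rcases Nat.eq_zero_or_pos ⌈P4 D / bigT D⌉₊ with h0 | hpos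
  · rw [h0, Nat.cast_zero, Real.log_zero]; positivity
  have hN0 : (0 : ℝ) < (⌈P4 D / bigT D⌉₊ : ℕ) := by exact_mod_cast hpos
  calc Real.log (⌈P4 D / bigT D⌉₊ : ℕ) ≤ Real.log (2 * (bigP D * t0 D)) := Real.log_le_log hN0 hN
    _ = Real.log 2 + ell D ^ 9 + 519 * Real.log (ell D) := by
        rw [Real.log_mul (by norm_num) (by positivity), Real.log_mul hP.ne' (by positivity), bigP,
          Real.log_exp, t0, Real.log_pow]; push_cast; ring
    _ ≤ 1 + ell D ^ 9 + 519 * ell D ^ 9 := by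
        have h2 : Real.log 2 ≤ 1 := by
          have := Real.log_two_lt_d9; norm_num at this; linarith
        have hlog : Real.log (ell D) ≤ ell D ^ 9 := by
          have h1 : Real.log (ell D) ≤ ell D := (Real.log_le_sub_one_of_pos hℓ0).trans (by linarith)
          exact h1.trans (le_self_pow₀ hℓ1 (by norm_num))
        linarith
    _ ≤ 521 * ell D ^ 9 := by
        have : (1 : ℝ) ≤ ell D ^ 9 := one_le_pow₀ hℓ1
        linarith

/-- **The `m₁`-sum at a fixed large modulus.** For `𝓛 = log D ≥ 3`, `q₁ ≥ 1`, `m₂ ≥ 1`: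
`Σ_{m₁} |b(q₁m₁)|·|κ̄₂(m₁m₂)|/m₁ ≤ B·exp(2|b₁|(521𝓛⁹ + log 4) + S₂)·τ₂(q₁)·|κ̄₂(m₂)|·(m₂/φ(m₂))²`,
`B = (1+|ι₂|)(|ι₃|+|ι₄|)`. [cite: Zhang2022LandauSiegel, §17 u021 p.98] -/
theorem m1Sum_le_at (c' : ℝ) {D : ℕ} (hℓ : 3 ≤ ell D) {q₁ m₂ : ℕ} (hq₁ : 1 ≤ q₁) (hm₂ : 1 ≤ m₂) :
    (∑' m₁ : ℕ, ‖bcoef D (q₁ * m₁)‖ * ‖kappa2bar c' D (m₁ * m₂)‖ / (m₁ : ℝ)) ≤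
      ((1 + ‖iota2‖) * (‖iota3‖ + ‖iota4‖) *
        Real.exp (2 * |b1 c' D| * (521 * ell D ^ 9 + Real.log 4) + LogEulerProduct.tailConst 2)) *
        (q₁.divisors.card : ℝ) * ‖kappa2bar c' D m₂‖ * ((m₂ : ℝ) / m₂.totient) ^ 2 := by
  classical
  have hlog2 : 2 ≤ Real.log D := by rw [← ell]; linarith
  set Bb : ℝ := (1 + ‖iota2‖) * (‖iota3‖ + ‖iota4‖) with hBb
  have hBb0 : 0 ≤ Bb := by positivity
  set b : ℝ := b1 c' D with hbdef
  set N : ℕ := ⌈P4 D / bigT D⌉₊ with hNdef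
  set Sm : Finset ℕ := m₂.primeFactors with hSm
  have hm₂0 : m₂ ≠ 0 := by omega
  have hq₁0 : q₁ ≠ 0 := by omega
  -- the summand and its support
  set F : ℕ → ℝ := fun m₁ => ‖bcoef D (q₁ * m₁)‖ * ‖kappa2bar c' D (m₁ * m₂)‖ / (m₁ : ℝ) with hF
  have hsupp : ∀ m₁ ∉ Icc 1 N, F m₁ = 0 := by
    intro m₁ hm₁
    rcases Nat.eq_zero_or_pos m₁ with rfl | hpos
    · simp [hF]
    · have hgt : N < m₁ := by
        by_contra h; exact hm₁ (Finset.mem_Icc.mpr ⟨hpos, not_lt.mp h⟩)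
      have hb : bcoef D (q₁ * m₁) = 0 := by
        refine bcoef_eq_zero_of_P4_div_bigT_le hℓ ?_
        calc P4 D / bigT D ≤ (N : ℝ) := Nat.le_ceil _
          _ ≤ (m₁ : ℝ) := by exact_mod_cast hgt.le
          _ ≤ ((q₁ * m₁ : ℕ) : ℝ) := by exact_mod_cast Nat.le_mul_of_pos_left m₁ (by omega)
      simp [hF, hb]
  rw [tsum_eq_sum (s := Icc 1 N) (fun m₁ hm₁ => hsupp m₁ hm₁)]
  -- termwise bound by the multiplicative weight
  have hterm : ∀ m₁ ∈ Icc 1 N, F m₁ ≤ Bb * (q₁.divisors.card : ℝ) * ‖kappa2bar c' D m₂‖ *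
      (tau 2 m₁ * (∏ q ∈ m₁.primeFactors \ Sm, ‖powI b q - 1‖) / m₁) := by
    intro m₁ hm₁
    have hm₁1 : 1 ≤ m₁ := (Finset.mem_Icc.mp hm₁).1
    have hm₁0 : m₁ ≠ 0 := by omega
    have hm₁pos : (0 : ℝ) < m₁ := by exact_mod_cast hm₁1
    -- `|b(q₁m₁)| ≤ B τ₂(q₁) τ₂(m₁)`
    have hb : ‖bcoef D (q₁ * m₁)‖ ≤ Bb * ((q₁.divisors.card : ℝ) * tau 2 m₁) := by
      refine (norm_bcoef_le hlog2 (q₁ * m₁)).trans ?_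
      refine mul_le_mul_of_nonneg_left ?_ hBb0
      rw [← tau_two_apply]
      exact tau_mul_le 2 q₁ m₁
    -- `|κ̄₂(m₁m₂)| = |κ₂(m₂)|·∏_{q∣m₁,q∤m₂}|q^{−ib}−1|`
    have hκ : ‖kappa2bar c' D (m₁ * m₂)‖ =
        ‖kappa2bar c' D m₂‖ * ∏ q ∈ m₁.primeFactors \ Sm, ‖powI b q - 1‖ := by
      rw [norm_kappa2bar_eq, norm_kappa2bar_eq, mul_comm m₁ m₂, norm_kappa₂_mul_eq _ hm₂0 hm₁0]
    simp only [hF]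
    rw [hκ]
    have hprod0 : 0 ≤ ∏ q ∈ m₁.primeFactors \ Sm, ‖powI b q - 1‖ :=
      Finset.prod_nonneg fun _ _ => norm_nonneg _
    calc ‖bcoef D (q₁ * m₁)‖ * (‖kappa2bar c' D m₂‖ * ∏ q ∈ m₁.primeFactors \ Sm, ‖powI b q - 1‖) / m₁
        ≤ Bb * ((q₁.divisors.card : ℝ) * tau 2 m₁) *
            (‖kappa2bar c' D m₂‖ * ∏ q ∈ m₁.primeFactors \ Sm, ‖powI b q - 1‖) / m₁ := by
          gcongr
      _ = Bb * (q₁.divisors.card : ℝ) * ‖kappa2bar c' D m₂‖ *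
            (tau 2 m₁ * (∏ q ∈ m₁.primeFactors \ Sm, ‖powI b q - 1‖) / m₁) := by ring
  -- sum, then Hall–Tenenbaum
  have hHT := sum_tau_mul_prod_sdiff_div_le b Sm N
  have hK0 : 0 ≤ Bb * (q₁.divisors.card : ℝ) * ‖kappa2bar c' D m₂‖ := by positivity
  calc ∑ m₁ ∈ Icc 1 N, F m₁
      ≤ ∑ m₁ ∈ Icc 1 N, Bb * (q₁.divisors.card : ℝ) * ‖kappa2bar c' D m₂‖ *
          (tau 2 m₁ * (∏ q ∈ m₁.primeFactors \ Sm, ‖powI b q - 1‖) / m₁) := Finset.sum_le_sum hterm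
    _ = Bb * (q₁.divisors.card : ℝ) * ‖kappa2bar c' D m₂‖ *
          ∑ m₁ ∈ Icc 1 N, tau 2 m₁ * (∏ q ∈ m₁.primeFactors \ Sm, ‖powI b q - 1‖) / m₁ := by
        rw [Finset.mul_sum]
    _ ≤ Bb * (q₁.divisors.card : ℝ) * ‖kappa2bar c' D m₂‖ *
          (Real.exp (2 * |b| * (Real.log N + Real.log 4) + LogEulerProduct.tailConst 2) *
            Real.exp (2 * ∑ p ∈ Sm, (p : ℝ)⁻¹)) := mul_le_mul_of_nonneg_left hHT hK0
    _ ≤ Bb * (q₁.divisors.card : ℝ) * ‖kappa2bar c' D m₂‖ *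
          (Real.exp (2 * |b| * (521 * ell D ^ 9 + Real.log 4) + LogEulerProduct.tailConst 2) *
            ((m₂ : ℝ) / m₂.totient) ^ 2) := by
        refine mul_le_mul_of_nonneg_left ?_ hK0
        refine mul_le_mul ?_ (exp_two_mul_sum_inv_primeFactors_le hm₂0) (Real.exp_pos _).le
          (Real.exp_pos _).le
        rw [Real.exp_le_exp]
        have hlogN := log_ceil_P4_div_bigT_le (D := D) hℓ
        have hb0 : 0 ≤ |b| := abs_nonneg _
        nlinarith
    _ = Bb * Real.exp (2 * |b| * (521 * ell D ^ 9 + Real.log 4) + LogEulerProduct.tailConst 2) *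
          (q₁.divisors.card : ℝ) * ‖kappa2bar c' D m₂‖ * ((m₂ : ℝ) / m₂.totient) ^ 2 := by ring

/-! ## §4. Piece (M1) of the `R₁` skeleton -/

/-- **Piece (M1) of the `R₁`-remainder of §17.u021 («m₁ inside»)**: there is `C = C(c′)` such
that for all large `D`, every quadratic primitive `χ (mod D)` (not used), every `q₁ ≥ 1` and
`m₂ ≥ 1`,
`Σ_{m₁} |b(q₁m₁)|·|κ̄₂(m₁m₂)|/m₁ ≤ C·τ₂(q₁)·|κ̄₂(m₂)|·(m₂/φ(m₂))²`
— the `m₁`-sum of the `m₂ ≥ 2` remainder `R₁` with the full `κ`-gain `|κ̄₂(m₂)|` kept (the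
primes of `m₁` outside `m₂` are absorbed by Hall–Tenenbaum with `2|b₁|log(4N) = O_{c′}(1)`,
`α log P = π`; those inside `m₂` cost `(m₂/φ(m₂))²`). Statement = the owner's cut text (M1)
verbatim (HOME/libB/zl-libB-p6/R1-NODE.md); this is the "acceptable error" bookkeeping of §17 p. 98
(tex L4825) for which v1 gives no argument; nothing about Landau–Siegel zeros follows.
[cite: Zhang2022LandauSiegel, §17 u021 p.98] -/
theorem m1Sum_le (c' : ℝ) : ∃ C : ℝ, ForAllLarge fun D _ _ => ∀ q₁ m₂ : ℕ, 1 ≤ q₁ → 1 ≤ m₂ →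
    (∑' m₁ : ℕ, ‖bcoef D (q₁ * m₁)‖ * ‖kappa2bar c' D (m₁ * m₂)‖ / (m₁ : ℝ)) ≤
      C * (q₁.divisors.card : ℝ) * ‖kappa2bar c' D m₂‖ * ((m₂ : ℝ) / m₂.totient) ^ 2 := by
  refine ⟨(1 + ‖iota2‖) * (‖iota3‖ + ‖iota4‖) *
      Real.exp (2 * (521 * π * (1 + 5 * |c'|)) + 2 * (1 + 5 * |c'|) * Real.log 4 +
        LogEulerProduct.tailConst 2),
    ⌈Real.exp 3⌉₊, fun D _ _ hD _ _ q₁ m₂ hq₁ hm₂ => ?_⟩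
  have hexp : Real.exp 3 ≤ D := le_trans (Nat.le_ceil _) (by exact_mod_cast hD)
  have hD0 : (0 : ℝ) < D := lt_of_lt_of_le (Real.exp_pos _) hexp
  have hℓ : 3 ≤ ell D := by rw [ell]; exact (Real.le_log_iff_exp_le hD0).mpr hexp
  have hℓ2 : 2 ≤ ell D := by linarith
  have hℓ0 : 0 < ell D := by linarith
  refine (m1Sum_le_at c' hℓ hq₁ hm₂).trans ?_
  have hrest : 0 ≤ (q₁.divisors.card : ℝ) * ‖kappa2bar c' D m₂‖ * ((m₂ : ℝ) / m₂.totient) ^ 2 := by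
    positivity
  have hB0 : 0 ≤ (1 + ‖iota2‖) * (‖iota3‖ + ‖iota4‖) := by positivity
  -- compare the exponents: `2|b₁|(521𝓛⁹ + log 4) ≤ 2·521π(1+5|c′|) + 2(1+5|c′|)log 4`
  have hα : alpha D = π / ell D ^ 9 := by rw [alpha, bigP, Real.log_exp]
  have hb := abs_b1_le c' hℓ2
  have hlog4 : 0 ≤ Real.log 4 := Real.log_nonneg (by norm_num)
  have hαℓ9 : alpha D * ell D ^ 9 = π := by rw [hα]; field_simp
  have hα1 : alpha D ≤ 1 := by
    rw [hα, div_le_one (by positivity)]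
    have : (1 : ℝ) ≤ ell D ^ 9 := one_le_pow₀ (by linarith)
    nlinarith [Real.pi_lt_four, this, pow_le_pow_left₀ (by norm_num : (0:ℝ) ≤ 2) hℓ2 9]
  have hkey : 2 * |b1 c' D| * (521 * ell D ^ 9 + Real.log 4) ≤
      2 * (521 * π * (1 + 5 * |c'|)) + 2 * (1 + 5 * |c'|) * Real.log 4 := by
    have h1 : |b1 c' D| * ell D ^ 9 ≤ π * (1 + 5 * |c'|) := by
      calc |b1 c' D| * ell D ^ 9 ≤ alpha D * (1 + 5 * |c'|) * ell D ^ 9 :=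
            mul_le_mul_of_nonneg_right hb (by positivity)
        _ = π * (1 + 5 * |c'|) := by rw [mul_assoc, mul_comm (1 + 5 * |c'|), ← mul_assoc, hαℓ9]
    have h2 : |b1 c' D| ≤ 1 + 5 * |c'| := by
      calc |b1 c' D| ≤ alpha D * (1 + 5 * |c'|) := hb
        _ ≤ 1 * (1 + 5 * |c'|) := mul_le_mul_of_nonneg_right hα1 (by positivity)
        _ = 1 + 5 * |c'| := one_mul _
    nlinarith [abs_nonneg (b1 c' D)]
  have hexp_le : Real.exp (2 * |b1 c' D| * (521 * ell D ^ 9 + Real.log 4) + LogEulerProduct.tailConst 2)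
      ≤ Real.exp (2 * (521 * π * (1 + 5 * |c'|)) + 2 * (1 + 5 * |c'|) * Real.log 4 +
        LogEulerProduct.tailConst 2) := Real.exp_le_exp.mpr (by linarith)
  calc (1 + ‖iota2‖) * (‖iota3‖ + ‖iota4‖) *
        Real.exp (2 * |b1 c' D| * (521 * ell D ^ 9 + Real.log 4) + LogEulerProduct.tailConst 2) *
        (q₁.divisors.card : ℝ) * ‖kappa2bar c' D m₂‖ * ((m₂ : ℝ) / m₂.totient) ^ 2
      = ((1 + ‖iota2‖) * (‖iota3‖ + ‖iota4‖) *
        Real.exp (2 * |b1 c' D| * (521 * ell D ^ 9 + Real.log 4) + LogEulerProduct.tailConst 2)) *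
        ((q₁.divisors.card : ℝ) * ‖kappa2bar c' D m₂‖ * ((m₂ : ℝ) / m₂.totient) ^ 2) := by ring
    _ ≤ ((1 + ‖iota2‖) * (‖iota3‖ + ‖iota4‖) *
        Real.exp (2 * (521 * π * (1 + 5 * |c'|)) + 2 * (1 + 5 * |c'|) * Real.log 4 +
          LogEulerProduct.tailConst 2)) *
        ((q₁.divisors.card : ℝ) * ‖kappa2bar c' D m₂‖ * ((m₂ : ℝ) / m₂.totient) ^ 2) :=
        mul_le_mul_of_nonneg_right (mul_le_mul_of_nonneg_left hexp_le hB0) hrest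
    _ = _ := by ring

end Literature.NumberTheory.LFunctions.Zhang2022.Typed.Section17
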